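import Summits.RiemannHypothesis.RiemannHypothesis.Theorems.WeilCombCombShapePositivityStubReductionLocal
import Summits.RiemannHypothesis.RiemannHypothesis.Theorems.WeilCombCombShapePositivitySymbolRealEven
import Literature.NumberTheory.LFunctions.WeilExplicit
import Mathlib

/-!
# Stub `stub_fejerLatticeMinors` (plan T5d, "lattice minors") for crux `WeilComb.CombShapePositivity`
(item stmt-RiemannHypothesis-11229, route route-RiemannHypothesis-WeilComb, line `Sketch`,
stub-plan `Cruxes/CombShapePositivity/STUB-PLAN-stub_fejer.md`, tier T5d; a `--supports` corollary,
not a step of the crux composition)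

Notation: `φ_ε(t) = ε⁻¹ expNegInvGlue (1 − (t/ε)²)` (the route bump at width `ε`),
`ψ_ε = φ_ε ⋆ φ̃_ε = weilConv φ_ε (weilReflect φ_ε)`, `τ_x h = weilTranslate h x = h(· − x)`,
`W = weilFunctional`, comb symbol `w_ε(x) = W(τ_x ψ_ε)`, `Q = weilQuadratic` (`Q g = W(g ⋆ g̃)`).
Fejér face at level `n`, prime set `S`, angles `θ`:
`Re Σ_{d,d' ∣ ∏_{p∈S} p^n} χ_θ(d) conj χ_θ(d') w_ε(log d − log d')`, `χ_θ(d) = exp(i Σ_{p∈S} θ_p v_p(d))`.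

**Statement (T5d).** Fix `ε > 0`, a finite set of primes `S` and `n₀`. If every Fejér face of width
`ε` over `S` at level `n ≥ n₀` is `≥ 0`, then for all positive `S`-smooth integers `d, d'`:
`‖w_ε(log d − log d')‖ ≤ Re Q(φ_ε)` (`= w_ε(0)`), i.e. every `2 × 2` principal minor of the
(real symmetric) Gram matrix `[w_ε(log m − log m')]` on the `S`-unit lattice is `≥ 0` — a necessary
condition usable at every `S`-unit lag.

**Proof.** By the S-local Bohr–Fejér reduction `reduction_local` (an arbitrary kernel), the face
hypothesis gives `Re Σ_{m,m' ∈ T} c_m conj c_{m'} w_ε(log m − log m') ≥ 0` for every finite set `T`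
of positive `S`-smooth integers and every `c`. With `T = {d}`, `c = 1`: `Re w_ε(0) ≥ 0`. With
`T = {d, d'}` (`d ≠ d'`), `c_d = 1`, `c_{d'} = s = ±1`, using that the symbol is even
(`weilFunctional_translate_psi_real_even`): `2 Re w_ε(0) + 2 s Re w_ε(x) ≥ 0`, `x = log d − log d'`;
hence `|Re w_ε(x)| ≤ Re w_ε(0)`. The symbol is real (same lemma), so `‖w_ε(x)‖ = |Re w_ε(x)|`, and
`w_ε(0) = W(τ_0 ψ_ε) = W(ψ_ε) = Q(φ_ε)` (`τ_0 = id`). The algebra is done once for an arbitrary real,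
even kernel `w` (`latticeMinors_kernel`).
-/

noncomputable section

-- the sub-problem path RiemannHypothesis/RiemannHypothesis duplicates a namespace (D-0017)
set_option linter.dupNamespace false

open scoped BigOperators ComplexConjugate Real
open Complex

namespace Summit.RiemannHypothesis.RiemannHypothesis.Theorems.WeilCombBohrFejer

open Literature.NumberTheory.LFunctions

/-- Lattice minors for an ARBITRARY real, even kernel `w`: if the Fejér faces of `w` over the prime
set `S` are `≥ 0` at every level `n ≥ n₀`, then `‖w(log d − log d')‖ ≤ Re w(0)` for all positive
`S`-smooth `d, d'` (the `1 × 1` and `2 × 2` principal minors of the PSD form supplied by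
`reduction_local`, tested against the vectors `(1)` and `(1, ±1)`). [folklore] -/
private theorem latticeMinors_kernel (w : ℝ → ℂ) (S : Finset ℕ) (hS : ∀ p ∈ S, p.Prime) (n₀ : ℕ)
    (hface : ∀ n : ℕ, n₀ ≤ n → ∀ θ : ℕ → ℝ,
      0 ≤ (∑ d ∈ (∏ p ∈ S, p ^ n).divisors, ∑ d' ∈ (∏ p ∈ S, p ^ n).divisors,
        Complex.exp (I * ((∑ p ∈ S, θ p * (d.factorization p : ℝ) : ℝ) : ℂ)) *
          conj (Complex.exp (I * ((∑ p ∈ S, θ p * (d'.factorization p : ℝ) : ℝ) : ℂ))) *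
          w (Real.log (d : ℝ) - Real.log (d' : ℝ))).re)
    (hreal : ∀ x : ℝ, (w x).im = 0) (heven : ∀ x : ℝ, w (-x) = w x)
    {d d' : ℕ} (hd : d ≠ 0) (hd' : d' ≠ 0) (hdS : d.primeFactors ⊆ S)
    (hd'S : d'.primeFactors ⊆ S) :
    ‖w (Real.log (d : ℝ) - Real.log (d' : ℝ))‖ ≤ (w 0).re := by
  have hpsd := reduction_local w S hS n₀ hface
  -- the `1 × 1` minor: `Re w(0) ≥ 0`
  have h1 : 0 ≤ (w 0).re := by
    have h := hpsd {d} (fun m hm => by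
      rw [Finset.mem_singleton] at hm
      exact hm ▸ ⟨hd, hdS⟩) (fun _ => 1)
    simpa using h
  -- the `2 × 2` minors: `|Re w(x)| ≤ Re w(0)`
  have key : |(w (Real.log (d : ℝ) - Real.log (d' : ℝ))).re| ≤ (w 0).re := by
    rcases eq_or_ne d d' with rfl | hne
    · simp [abs_of_nonneg h1]
    · have hT : ∀ m ∈ ({d, d'} : Finset ℕ), m ≠ 0 ∧ m.primeFactors ⊆ S := by
        intro m hm
        simp only [Finset.mem_insert, Finset.mem_singleton] at hm
        rcases hm with rfl | rfl
        exacts [⟨hd, hdS⟩, ⟨hd', hd'S⟩]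
      have two : ∀ s : ℝ, s * s = 1 →
          0 ≤ (w 0).re + s * (w (Real.log (d : ℝ) - Real.log (d' : ℝ))).re := by
        intro s hs
        have h := hpsd {d, d'} hT (fun m => if m = d then 1 else (s : ℂ))
        rw [Finset.sum_pair hne, Finset.sum_pair hne, Finset.sum_pair hne] at h
        simp only [if_true, if_neg hne.symm, sub_self] at h
        rw [show Real.log (d' : ℝ) - Real.log (d : ℝ) = -(Real.log (d : ℝ) - Real.log (d' : ℝ)) by
          ring, heven] at h
        simp only [map_one, Complex.conj_ofReal, Complex.add_re, Complex.mul_re, Complex.one_re,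
          Complex.one_im, Complex.ofReal_re, Complex.ofReal_im, hreal] at h
        nlinarith [h, hs]
      rw [abs_le]
      constructor
      · have := two 1 (by norm_num)
        linarith
      · have := two (-1) (by norm_num)
        linarith
  rwa [Complex.abs_re_eq_norm.2 (hreal _)] at key

/-- **Stub `stub_fejerLatticeMinors` (plan T5d, lattice minors).** At a FIXED width `ε > 0` and a
FIXED finite prime set `S`: if the Fejér faces
`Re Σ_{d,d' ∣ ∏_{p∈S} p^n} χ_θ(d) conj χ_θ(d') w_ε(log d − log d')` are `≥ 0` for all levels `n ≥ n₀`
and all angles `θ`, then `‖w_ε(log d − log d')‖ ≤ Re Q(φ_ε)` for all positive `S`-smooth integers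
`d, d'`, where `w_ε(x) = W(τ_x(φ_ε ⋆ φ̃_ε))` is the comb symbol and `Q(φ_ε) = W(φ_ε ⋆ φ̃_ε) = w_ε(0)`.
Proof: `latticeMinors_kernel` for the comb symbol, which is real and even
(`weilFunctional_translate_psi_real_even`), and `τ_0 ψ = ψ`. [folklore] -/
theorem stub_fejerLatticeMinors : ∀ ε : ℝ, 0 < ε → ∀ S : Finset ℕ, (∀ p ∈ S, p.Prime) → ∀ n₀ : ℕ,
  (∀ n : ℕ, n₀ ≤ n → ∀ θ : ℕ → ℝ,
    0 ≤ (∑ d ∈ (∏ p ∈ S, p ^ n).divisors, ∑ d' ∈ (∏ p ∈ S, p ^ n).divisors,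
      Complex.exp (I * ((∑ p ∈ S, θ p * (d.factorization p : ℝ) : ℝ) : ℂ)) *
        conj (Complex.exp (I * ((∑ p ∈ S, θ p * (d'.factorization p : ℝ) : ℝ) : ℂ))) *
        weilFunctional (weilTranslate
          (weilConv (fun t : ℝ => (ε : ℂ)⁻¹ * ((expNegInvGlue (1 - (t / ε) ^ 2) : ℝ) : ℂ))
            (weilReflect (fun t : ℝ => (ε : ℂ)⁻¹ * ((expNegInvGlue (1 - (t / ε) ^ 2) : ℝ) : ℂ))))
          (Real.log (d : ℝ) - Real.log (d' : ℝ)))).re) →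
  ∀ d d' : ℕ, d ≠ 0 → d' ≠ 0 → d.primeFactors ⊆ S → d'.primeFactors ⊆ S →
    ‖weilFunctional (weilTranslate
        (weilConv (fun t : ℝ => (ε : ℂ)⁻¹ * ((expNegInvGlue (1 - (t / ε) ^ 2) : ℝ) : ℂ))
          (weilReflect (fun t : ℝ => (ε : ℂ)⁻¹ * ((expNegInvGlue (1 - (t / ε) ^ 2) : ℝ) : ℂ))))
        (Real.log (d : ℝ) - Real.log (d' : ℝ)))‖ ≤
      (weilQuadratic (fun t : ℝ => (ε : ℂ)⁻¹ * ((expNegInvGlue (1 - (t / ε) ^ 2) : ℝ) : ℂ))).re := by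
  intro ε hε S hS n₀ hface d d' hd hd' hdS hd'S
  have hre := weilFunctional_translate_psi_real_even ε hε
  -- the kernel is passed as an explicit lambda (a `_` kernel would unfold `weilFunctional`)
  have h := latticeMinors_kernel
    (fun y : ℝ => weilFunctional (weilTranslate
      (weilConv (fun t : ℝ => (ε : ℂ)⁻¹ * ((expNegInvGlue (1 - (t / ε) ^ 2) : ℝ) : ℂ))
        (weilReflect (fun t : ℝ => (ε : ℂ)⁻¹ * ((expNegInvGlue (1 - (t / ε) ^ 2) : ℝ) : ℂ)))) y))
    S hS n₀ hface (fun x => (hre x).1) (fun x => (hre x).2) hd hd' hdS hd'S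
  -- `τ_0 ψ = ψ`, so `w_ε(0) = W(ψ_ε) = Q(φ_ε)`
  have h0 : ∀ ψ : ℝ → ℂ, weilTranslate ψ 0 = ψ := fun ψ => by
    funext t
    simp [weilTranslate]
  simpa only [h0, weilQuadratic] using h

end Summit.RiemannHypothesis.RiemannHypothesis.Theorems.WeilCombBohrFejer

end
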